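import Summits.ResolutionOfSingularities.ResolutionOfSingularities.Theorems.FrobeniusLadderFInjectiveMacaulayficationBadMaximalPoints
import Summits.ResolutionOfSingularities.ResolutionOfSingularities.Theorems.FrobeniusLadderFInjectiveMacaulayficationMeasureDescent
import Summits.ResolutionOfSingularities.ResolutionOfSingularities.Theorems.FrobeniusLadderFInjectiveMacaulayficationMaximalBadPoint
import Summits.ResolutionOfSingularities.ResolutionOfSingularities.Theorems.FrobeniusLadderFInjectiveMacaulayficationIsoLocusTransport
import Summits.ResolutionOfSingularities.ResolutionOfSingularities.Theorems.FrobeniusLadderFInjectiveMacaulayficationFiLocusOpenOfAffine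
import Literature.AlgebraicGeometry.Resolution.FInjectiveLocusOpen
import Mathlib.AlgebraicGeometry.Noetherian
import Mathlib.AlgebraicGeometry.Morphisms.FiniteType
import HarnessLib

/-!
# Hole #3 from STRONG⁺ confined steps (R3″ `GenericFInjectivizationOfSteps` of the hole-#3 interfaces v3)

[OURS · L1 W4.5a] Support file for crux stmt-ResolutionOfSingularities-15315
(`Summit.ResolutionOfSingularities.ResolutionOfSingularities.Theses.FrobeniusLadder.FInjectiveMacaulayfication`, route
`FrobeniusLadder`, skeleton v11 `86e9127b5c98b8e6`), hole #3 = registered stub `stub_genericFInjectivization`.  The planner's hole-#3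
interfaces v3 (`L/w45a/HoleThreeInterfaces3.lean`, ruling 2026-08-27T02:04:37Z) type the reduction of hole #3 to LOCAL steps as
R3″ `GenericFInjectivizationOfSteps p := DattaMurayama2024_fInjectiveLocusOpen.{0} → ConfinedIsoStepStrongPlus p → p.Prime → ⟨stub #3 at p⟩`,
where a STRONG⁺ step at `η ∈ MaxBadNonClosed(X₁)` (non-closed, Frobenius clause fails, holds at every proper generization) is a proper
birational everywhere-CM integral `π : X₂ ⟶ X₁` which is an isomorphism off `closure {η}` EXACTLY and has the FULL clause at every
NON-CLOSED point over `closure {η}` (closed bad points over the component are hole #4's).  This file PROVES R3″ with the planner's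
abbreviations unfolded (`genericFInjectivization_of_strongPlusStep`; the planner's `GenericFInjectivizationOfSteps p` follows by `exact`):

measure = number of NON-CLOSED generization-maximal points failing the Frobenius clause — finite because the bad locus is closed
(Datta–Murayama, ring level `DattaMurayama2024_fInjectiveLocusOpen` ⟶ scheme level `FiLocusOpenOfAffine.fiLocusOpen_of_ringLevel`) and
`X` is Noetherian sober (`BadMaximalPoints.finite_setOf_maximal_of_isClosed`); strictly decreasing under a STRONG⁺ step
(`BadMaximalPoints.card_maximal_nonclosed_lt_of_strongPlusStep` with `IsoLocusTransport.fClause_iff_of_isIso_morphismRestrict`); a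
member from any non-closed bad point (`MaximalBadPoint.exists_maximal_not_of_exists_not_isClosed`); composition by
`MeasureDescent.genericFInjectivization_of_stateMeasure` (states = admissible pairs at the fixed `p, k`).  Companion of
`GenericFInjectivizationOfSuperStrongStep` (clause at ALL points over the closure).  No definition is declared; AI-written, weaker than
expert review; no statement of [claim: Hironaka2017] is used. [folklore]
-/

-- single-problem summit: the doubled namespace component `ResolutionOfSingularities` is forced
set_option linter.dupNamespace false

noncomputable section

open CategoryTheory AlgebraicGeometry TopologicalSpace
open Literature.AlgebraicGeometry.Resolution
open Summit.ResolutionOfSingularities.ResolutionOfSingularities.Theorems.FInjectiveMacaulayfication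

namespace Summit.ResolutionOfSingularities.ResolutionOfSingularities.Theorems.FInjectiveMacaulayfication.GenericFInjectivizationOfStrongPlusStep

/-- **R3″: hole #3 at `p` ⟸ Datta–Murayama + STRONG⁺ confined steps at `p`** (the planner's `GenericFInjectivizationOfSteps p` with
`MaxBadNonClosed`, `complClosure`, `CMClause`, `FClause`, `FiClause` unfolded; conclusion = the registered signature of
`stub_genericFInjectivization` at the fixed prime `p`, verbatim). [folklore] -/
theorem genericFInjectivization_of_strongPlusStep (p : ℕ)
    (hDM : DattaMurayama2024_fInjectiveLocusOpen.{0})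
    (step : ∀ (k : Type) [Field k] [CharP k p] (X₁ : Scheme.{0}) (f₁ : X₁ ⟶ Spec (.of k)),
      IsSeparated f₁ → LocallyOfFiniteType f₁ → QuasiCompact f₁ → IsIntegral X₁ →
      (∀ x : X₁, (∀ d : ℕ, ringKrullDim (X₁.presheaf.stalk x) = d → ∀ s : Fin d → X₁.presheaf.stalk x, (Ideal.span (Set.range s)).radical.IsMaximal → RingTheory.Sequence.IsWeaklyRegular (X₁.presheaf.stalk x) (List.ofFn s))) →
      ∀ η : X₁, (¬ IsClosed ({η} : Set X₁) ∧ ¬ (∀ d : ℕ, ringKrullDim (X₁.presheaf.stalk η) = d → ∀ s : Fin d → X₁.presheaf.stalk η, (Ideal.span (Set.range s)).radical.IsMaximal → ∀ t : X₁.presheaf.stalk η, (∃ e : ℕ, t ^ p ^ e ∈ Ideal.span ((fun z : X₁.presheaf.stalk η => z ^ p ^ e) '' (Ideal.span (Set.range s) : Set (X₁.presheaf.stalk η)))) → t ∈ Ideal.span (Set.range s)) ∧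
        ∀ y : X₁, y ⤳ η → y ≠ η → (∀ d : ℕ, ringKrullDim (X₁.presheaf.stalk y) = d → ∀ s : Fin d → X₁.presheaf.stalk y, (Ideal.span (Set.range s)).radical.IsMaximal → ∀ t : X₁.presheaf.stalk y, (∃ e : ℕ, t ^ p ^ e ∈ Ideal.span ((fun z : X₁.presheaf.stalk y => z ^ p ^ e) '' (Ideal.span (Set.range s) : Set (X₁.presheaf.stalk y)))) → t ∈ Ideal.span (Set.range s))) →
        ∃ (X₂ : Scheme.{0}) (π : X₂ ⟶ X₁), IsProper π ∧ Literature.AlgebraicGeometry.Resolution.IsBirational π ∧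
          IsIntegral X₂ ∧ (∀ x : X₂, (∀ d : ℕ, ringKrullDim (X₂.presheaf.stalk x) = d → ∀ s : Fin d → X₂.presheaf.stalk x, (Ideal.span (Set.range s)).radical.IsMaximal → RingTheory.Sequence.IsWeaklyRegular (X₂.presheaf.stalk x) (List.ofFn s))) ∧
          IsIso (π ∣_ ⟨(closure ({η} : Set X₁))ᶜ, isClosed_closure.isOpen_compl⟩) ∧
          ∀ x : X₂, π.base x ∈ closure ({η} : Set X₁) → ¬ IsClosed ({x} : Set X₂) → (IsDomain (X₂.presheaf.stalk x) ∧ ∀ d : ℕ, ringKrullDim (X₂.presheaf.stalk x) = d → ∀ s : Fin d → X₂.presheaf.stalk x, (Ideal.span (Set.range s)).radical.IsMaximal → RingTheory.Sequence.IsWeaklyRegular (X₂.presheaf.stalk x) (List.ofFn s) ∧ ∀ t : X₂.presheaf.stalk x, (∃ e : ℕ, t ^ p ^ e ∈ Ideal.span ((fun z : X₂.presheaf.stalk x => z ^ p ^ e) '' (Ideal.span (Set.range s) : Set (X₂.presheaf.stalk x)))) → t ∈ Ideal.span (Set.range s)))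
    (hp : p.Prime) :
    ∀ (k : Type) [Field k] [CharP k p] (X₁ : Scheme.{0}) (f₁ : X₁ ⟶ Spec (.of k)), IsSeparated f₁ → LocallyOfFiniteType f₁ → QuasiCompact f₁ → IsIntegral X₁ → (∀ x : X₁, ∀ d : ℕ, ringKrullDim (X₁.presheaf.stalk x) = d → ∀ s : Fin d → X₁.presheaf.stalk x, (Ideal.span (Set.range s)).radical.IsMaximal → RingTheory.Sequence.IsWeaklyRegular (X₁.presheaf.stalk x) (List.ofFn s)) → ∃ (X₂ : Scheme.{0}) (π : X₂ ⟶ X₁), IsProper π ∧ Literature.AlgebraicGeometry.Resolution.IsBirational π ∧ IsIntegral X₂ ∧ (∀ x : X₂, ∀ d : ℕ, ringKrullDim (X₂.presheaf.stalk x) = d → ∀ s : Fin d → X₂.presheaf.stalk x, (Ideal.span (Set.range s)).radical.IsMaximal → RingTheory.Sequence.IsWeaklyRegular (X₂.presheaf.stalk x) (List.ofFn s)) ∧ ∀ x : X₂, ¬ IsClosed ({x} : Set X₂) → ∀ d : ℕ, ringKrullDim (X₂.presheaf.stalk x) = d → ∀ s : Fin d → X₂.presheaf.stalk x, (Ideal.span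 (Set.range s)).radical.IsMaximal → ∀ y : X₂.presheaf.stalk x, (∃ e : ℕ, y ^ p ^ e ∈ Ideal.span ((fun z : X₂.presheaf.stalk x => z ^ p ^ e) '' (Ideal.span (Set.range s) : Set (X₂.presheaf.stalk x)))) → y ∈ Ideal.span (Set.range s) := by
  intro k _ _ X₁ f₁ hsep hft hqc hint hCM
  haveI : Fact p.Prime := ⟨hp⟩
  -- states: admissible pairs over the fixed `k`
  let S : Type 1 := Σ X : Scheme.{0}, {f : X ⟶ Spec (.of k) // IsSeparated f ∧ LocallyOfFiniteType f ∧
    QuasiCompact f ∧ IsIntegral X ∧ ∀ x : X, (∀ d : ℕ, ringKrullDim (X.presheaf.stalk x) = d → ∀ s : Fin d → X.presheaf.stalk x, (Ideal.span (Set.range s)).radical.IsMaximal → RingTheory.Sequence.IsWeaklyRegular (X.presheaf.stalk x) (List.ofFn s))}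
  have key :=
    MeasureDescent.genericFInjectivization_of_stateMeasure p k (S := S) (W := ℕ) (· < ·) wellFounded_lt
      (fun σ => Nat.card {ξ : σ.1 // ¬ IsClosed ({ξ} : Set σ.1) ∧ ¬ (∀ d : ℕ, ringKrullDim (σ.1.presheaf.stalk ξ) = d → ∀ s : Fin d → σ.1.presheaf.stalk ξ, (Ideal.span (Set.range s)).radical.IsMaximal → ∀ t : σ.1.presheaf.stalk ξ, (∃ e : ℕ, t ^ p ^ e ∈ Ideal.span ((fun z : σ.1.presheaf.stalk ξ => z ^ p ^ e) '' (Ideal.span (Set.range s) : Set (σ.1.presheaf.stalk ξ)))) → t ∈ Ideal.span (Set.range s)) ∧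
        ∀ y : σ.1, ¬ (∀ d : ℕ, ringKrullDim (σ.1.presheaf.stalk y) = d → ∀ s : Fin d → σ.1.presheaf.stalk y, (Ideal.span (Set.range s)).radical.IsMaximal → ∀ t : σ.1.presheaf.stalk y, (∃ e : ℕ, t ^ p ^ e ∈ Ideal.span ((fun z : σ.1.presheaf.stalk y => z ^ p ^ e) '' (Ideal.span (Set.range s) : Set (σ.1.presheaf.stalk y)))) → t ∈ Ideal.span (Set.range s)) → y ⤳ ξ → y = ξ})
      (fun σ => σ.1) (fun σ => ⟨σ.2.2.2.2.2.1, σ.2.2.2.2.2.2⟩) ?_ ⟨X₁, f₁, hsep, hft, hqc, hint, hCM⟩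
  · obtain ⟨X₂, π, hπ, hbir, hint₂, hCM₂, hgood⟩ := key
    exact ⟨X₂, π, hπ, hbir, hint₂, hCM₂, hgood⟩
  -- the step on states
  rintro ⟨X, f, hsepX, hftX, hqcX, hintX, hCMX⟩ hbad
  haveI := hftX
  haveI := hqcX
  -- a maximal non-closed bad point
  obtain ⟨η, hηnc, hηbad, hηmax⟩ := MaximalBadPoint.exists_maximal_not_of_exists_not_isClosed f
    (fun x : X => (∀ d : ℕ, ringKrullDim (X.presheaf.stalk x) = d → ∀ s : Fin d → X.presheaf.stalk x, (Ideal.span (Set.range s)).radical.IsMaximal → ∀ t : X.presheaf.stalk x, (∃ e : ℕ, t ^ p ^ e ∈ Ideal.span ((fun z : X.presheaf.stalk x => z ^ p ^ e) '' (Ideal.span (Set.range s) : Set (X.presheaf.stalk x)))) → t ∈ Ideal.span (Set.range s))) hbad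
  obtain ⟨X', π, hπ, hbir, hint', hCM', hiso, hgood⟩ :=
    step k X f hsepX hftX hqcX hintX hCMX η ⟨hηnc, hηbad, hηmax⟩
  haveI := hπ
  have hsep' : IsSeparated (π ≫ f) := inferInstance
  have hft' : LocallyOfFiniteType (π ≫ f) := inferInstance
  have hqc' : QuasiCompact (π ≫ f) := inferInstance
  refine ⟨⟨X', π ≫ f, hsep', hft', hqc', hint', hCM'⟩, π, hπ, hbir, ?_⟩
  -- the bad locus of `X` is closed (Datta–Murayama, ring level → scheme level)
  have hopen := FiLocusOpenOfAffine.fiLocusOpen_of_ringLevel p k (hDM p hp k) X f hftX hCMX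
  have hclosed : IsClosed {x : X | ¬ (∀ d : ℕ, ringKrullDim (X.presheaf.stalk x) = d → ∀ s : Fin d → X.presheaf.stalk x, (Ideal.span (Set.range s)).radical.IsMaximal → ∀ t : X.presheaf.stalk x, (∃ e : ℕ, t ^ p ^ e ∈ Ideal.span ((fun z : X.presheaf.stalk x => z ^ p ^ e) '' (Ideal.span (Set.range s) : Set (X.presheaf.stalk x)))) → t ∈ Ideal.span (Set.range s))} := by
    rw [← isOpen_compl_iff]
    convert hopen using 1
    ext x
    simp only [Set.mem_compl_iff, Set.mem_setOf_eq, not_not]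
  haveI : IsLocallyNoetherian X := LocallyOfFiniteType.isLocallyNoetherian f
  haveI : CompactSpace X := QuasiCompact.compactSpace_of_compactSpace f
  haveI : IsNoetherian X := {}
  have hfin := BadMaximalPoints.finite_setOf_maximal_of_isClosed hclosed
  haveI := hiso
  refine BadMaximalPoints.card_maximal_nonclosed_lt_of_strongPlusStep π η
    ⟨(closure ({η} : Set X))ᶜ, isClosed_closure.isOpen_compl⟩ rfl
    (fun y : X => ¬ (∀ d : ℕ, ringKrullDim (X.presheaf.stalk y) = d → ∀ s : Fin d → X.presheaf.stalk y, (Ideal.span (Set.range s)).radical.IsMaximal → ∀ t : X.presheaf.stalk y, (∃ e : ℕ, t ^ p ^ e ∈ Ideal.span ((fun z : X.presheaf.stalk y => z ^ p ^ e) '' (Ideal.span (Set.range s) : Set (X.presheaf.stalk y)))) → t ∈ Ideal.span (Set.range s)))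
    (fun x : X' => ¬ (∀ d : ℕ, ringKrullDim (X'.presheaf.stalk x) = d → ∀ s : Fin d → X'.presheaf.stalk x, (Ideal.span (Set.range s)).radical.IsMaximal → ∀ t : X'.presheaf.stalk x, (∃ e : ℕ, t ^ p ^ e ∈ Ideal.span ((fun z : X'.presheaf.stalk x => z ^ p ^ e) '' (Ideal.span (Set.range s) : Set (X'.presheaf.stalk x)))) → t ∈ Ideal.span (Set.range s)))
    (fun x hx => not_congr (IsoLocusTransport.fClause_iff_of_isIso_morphismRestrict p π _ x hx).symm)
    (fun x hx hxc hb => hb fun d hd s hs => ((hgood x hx hxc).2 d hd s hs).2) ⟨hηnc, hηbad, fun y hy hsp => ?_⟩ ?_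
  · by_contra hne
    exact hy (hηmax y hsp hne)
  · simpa only [Set.mem_setOf_eq] using hfin

end Summit.ResolutionOfSingularities.ResolutionOfSingularities.Theorems.FInjectiveMacaulayfication.GenericFInjectivizationOfStrongPlusStep

end
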